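import Summits.CriticalPhenomena.PercolationContinuityZ3.Theorems.SahiThreeCoordinates
import Summits.CriticalPhenomena.PercolationContinuityZ3.Theorems.SahiThreeEdgesRandomCluster
import Summits.CriticalPhenomena.PercolationContinuityZ3.Theorems.PercNearOneGluingNoHeavyLowerTailSahiC3CubeFourFKGLattices

/-!
# Sahi's `C₃` for observables of at most FOUR coordinates of an ARBITRARY FKG measure — and for four spins of the Ising
# ferromagnet / four edges of the random-cluster model (standard axioms)

Companion of `SahiThreeCoordinates.lean` (cell `prim-sahi`, seat `prim-sahi-typer` gen 36; `--supports stmt-CriticalPhenomena-4575`).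
Theorems only (no definitions, no named facts, no sorries); axioms `propext`, `Classical.choice`, `Quot.sound` — everything rests on
P4's standard-axiom theorem `SahiC3CubeFourFKG.sahiPositive_three_cube_four` (`…SahiC3CubeFourFKG`: Sahi's `C₃` on `{0,1}⁴` for EVERY
FKG weight) and its corollaries `sahiPositive_three_set_of_card_le_four`, `sahiPositive_three_of_card_supIrred_le_four`
(`…SahiC3CubeFourFKGLattices`), combined with the finite Karlin–Rinott marginal theorem
(`Literature.Combinatorics.Sahi2008.sahiE_comp_nonneg_of_forall_isFKGMeasure`, `Marginals.lean`).

`SahiThreeCoordinates.lean` (typer gen 4) gives `C_n` for EVERY `n` through the settled lattice `{0,1}³`; here the settled object is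
`{0,1}⁴` AT ORDER `3` (all orders on `{0,1}⁴` for non-product FKG weights are open), so every statement is the order-`3` one:
* `sahiPositive_of_latticeEmbedding_at` — the fixed-order form of P1's `SahiSettledClass.sahiPositive_of_latticeEmbedding`
  (same proof): order-`n` Sahi positivity of all FKG weights passes to sublattices;
* `sahiE_three_comp_nonneg_of_latticeHom_cube_four` / `…_set_four` / `…_supIrred_le_four` — for every FKG probability weight `μ` on any
  finite distributive lattice `β`, every lattice homomorphism `G` into `{0,1}⁴`, `2^X` (`|X| ≤ 4`) or a lattice with `≤ 4` join-irreducibles,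
  and all nonnegative monotone `f₀, f₁, f₂`: `E₃^μ(f₀ ∘ G, f₁ ∘ G, f₂ ∘ G) ≥ 0`;
* **`sahiE_three_nonneg_of_fourCoordinates`** — on `{0,1}^ι`, any FKG weight: every triple of nonnegative observables depending monotonically
  on at most FOUR FIXED COORDINATES has `E₃ ≥ 0` (Sahi's Conjecture 5 at `n = 3` [Sahi2008, Conj. 5; LiebSahi2022, Conj. 1.1] on this class);
* `sahiPositive_three_spinCube_four` — every FKG probability weight on `{−1,+1}⁴` is Sahi-positive of order `3`;
* **`ising_sahiE_three_fourSites_nonneg`** — finite-volume Ising ferromagnet (`β ≥ 0`, ANY field, ANY boundary condition): for any four sites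
  and all nonnegative functions `g₀, g₁, g₂` of `(σ_{v₀},…,σ_{v₃})` nondecreasing in each spin, `E₃ ≥ 0`;
* **`rc_sahiE_three_fourEdges_nonneg`** — random-cluster model (`0 ≤ p ≤ 1`, `q ≥ 1`, any wired set): the same for functions of the states of
  any four edges.
SCOPE: statements about observables of `≤ 4` fixed sites/edges; they do not reach connectivity events. [this work]
-/

noncomputable section

namespace Summit.CriticalPhenomena.PercolationContinuityZ3.Theorems.SahiFourCoordinates

open Finset Function Literature.Combinatorics.Sahi2008
open scoped BigOperators

/-! ### Fixed-order settledness passes to sublattices -/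

section Embedding

variable {L P : Type*} [DistribLattice L] [Fintype L] [DistribLattice P] [Fintype P]

/-- **Order-`n` settledness passes to sublattices** (the fixed-order form of P1's `SahiSettledClass.sahiPositive_of_latticeEmbedding`, same
proof: push forward along the embedding, `isFKGMeasure_pushWeight`, and descend along the monotone retraction `p ↦ ⋁{x : e x ≤ p}`,
`SahiCubeAllOrders.sahiPositive_of_pushWeight_of_retract`).  If every FKG probability weight on `P` is Sahi-positive of order `n` and
`e : L → P` is injective and preserves `⊓`, `⊔`, then every FKG probability weight on `L` is Sahi-positive of order `n`. [this work] -/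
theorem sahiPositive_of_latticeEmbedding_at (e : L → P) (he : Function.Injective e)
    (hinf : ∀ x y, e (x ⊓ y) = e x ⊓ e y) (hsup : ∀ x y, e (x ⊔ y) = e x ⊔ e y) {n : ℕ}
    (hP : ∀ ν : P → ℝ, IsFKGMeasure ν → SahiPositive ν n) {μ : L → ℝ} (hμ : IsFKGMeasure μ) :
    SahiPositive μ n := by
  classical
  have hL : Nonempty L := by
    by_contra h
    rw [not_nonempty_iff] at h
    exact one_ne_zero (hμ.sum_eq_one.symm.trans (Fintype.sum_empty _))
  letI : OrderBot L := Fintype.toOrderBot L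
  have hle : ∀ x y, e x ≤ e y ↔ x ≤ y := by
    intro x y
    constructor
    · intro h
      have h1 : e (x ⊓ y) = e x := by rw [hinf]; exact inf_eq_left.2 h
      exact inf_eq_left.1 (he h1)
    · intro h
      have h1 : e x ⊓ e y = e x := by rw [← hinf, inf_eq_left.2 h]
      exact inf_eq_left.1 h1
  obtain ⟨R, hR⟩ : ∃ R : P → L, ∀ p, R p = (univ.filter fun x => e x ≤ p).sup id := ⟨_, fun p => rfl⟩
  have hRmono : Monotone R := by
    intro p p' hpp'
    rw [hR, hR]
    refine Finset.sup_mono fun x hx => ?_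
    rw [mem_filter] at hx ⊢
    exact ⟨hx.1, hx.2.trans hpp'⟩
  have hRE : ∀ x, R (e x) = x := by
    intro x
    rw [hR]
    refine le_antisymm (Finset.sup_le fun y hy => ?_) ?_
    · rw [mem_filter] at hy
      exact (hle y x).1 hy.2
    · exact Finset.le_sup (f := id) (by rw [mem_filter]; exact ⟨mem_univ _, le_rfl⟩)
  exact SahiCubeAllOrders.sahiPositive_of_pushWeight_of_retract hRmono hRE
    (hP _ (isFKGMeasure_pushWeight hμ he hinf hsup))

end Embedding

/-! ### Transfer through a lattice homomorphism into `{0,1}⁴`, `2^X` (`|X| ≤ 4`), or a lattice with `≤ 4` join-irreducibles -/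

section Transfer

variable {β : Type*} [Fintype β] [DistribLattice β]

/-- **`C₃` through `{0,1}⁴`.**  For every FKG probability weight `μ` on a finite distributive lattice, every lattice homomorphism
`G : β → (Fin 4 → Bool)` and all nonnegative monotone `f₀, f₁, f₂ : (Fin 4 → Bool) → ℝ`: `E₃^μ(f₀ ∘ G, f₁ ∘ G, f₂ ∘ G) ≥ 0`
(Karlin–Rinott marginal + P4's `sahiPositive_three_cube_four`). [this work] -/
theorem sahiE_three_comp_nonneg_of_latticeHom_cube_four {μ : β → ℝ} (hμ : IsFKGMeasure μ) (G : LatticeHom β (Fin 4 → Bool))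
    (f : Fin 3 → (Fin 4 → Bool) → ℝ) (hf0 : ∀ i c, 0 ≤ f i c) (hmono : ∀ i, Monotone (f i)) :
    0 ≤ sahiE μ 3 fun i => f i ∘ G :=
  sahiE_comp_nonneg_of_forall_isFKGMeasure hμ G (fun _ hν => SahiC3CubeFourFKG.sahiPositive_three_cube_four hν) f hf0 hmono

/-- **`C₃` through `2^X`, `|X| ≤ 4`** (Sahi's own setting; P4's `sahiPositive_three_set_of_card_le_four`). [this work] -/
theorem sahiE_three_comp_nonneg_of_latticeHom_set_four {μ : β → ℝ} (hμ : IsFKGMeasure μ) {X : Type*} [Fintype X]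
    (hX : Fintype.card X ≤ 4) (G : LatticeHom β (Set X)) (f : Fin 3 → Set X → ℝ) (hf0 : ∀ i c, 0 ≤ f i c)
    (hmono : ∀ i, Monotone (f i)) : 0 ≤ sahiE μ 3 fun i => f i ∘ G :=
  sahiE_comp_nonneg_of_forall_isFKGMeasure hμ G
    (fun _ hν => SahiC3CubeFourFKG.sahiPositive_three_set_of_card_le_four hX hν) f hf0 hmono

/-- **`C₃` through any finite distributive lattice with at most four join-irreducibles** (P4's
`sahiPositive_three_of_card_supIrred_le_four`). [this work] -/
theorem sahiE_three_comp_nonneg_of_latticeHom_supIrred_le_four {μ : β → ℝ} (hμ : IsFKGMeasure μ)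
    {γ : Type*} [Fintype γ] [DistribLattice γ] [DecidableEq γ] (h4 : Nat.card {j : γ // SupIrred j} ≤ 4)
    (G : LatticeHom β γ) (f : Fin 3 → γ → ℝ) (hf0 : ∀ i c, 0 ≤ f i c) (hmono : ∀ i, Monotone (f i)) :
    0 ≤ sahiE μ 3 fun i => f i ∘ G :=
  sahiE_comp_nonneg_of_forall_isFKGMeasure hμ G
    (fun _ hν => SahiC3CubeFourFKG.sahiPositive_three_of_card_supIrred_le_four h4 hν) f hf0 hmono

end Transfer

/-! ### Observables of at most four fixed coordinates -/

section Coordinates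

variable {ι : Type*} [Fintype ι] [DecidableEq ι]

/-- **Four coordinates of `{0,1}^ι`, any FKG weight, order 3.**  For every FKG probability weight `μ` on `ι → Bool`, every `e : Fin 4 → ι`
(four coordinates, repetitions allowed) and all nonnegative monotone `g₀, g₁, g₂ : (Fin 4 → Bool) → ℝ`, the observables
`ω ↦ gᵢ (ω ∘ e)` satisfy `E₃ ≥ 0` — Sahi's Conjecture 5 at `n = 3` for observables of four fixed coordinates. [this work] -/
theorem sahiE_three_nonneg_of_fourCoordinates {μ : (ι → Bool) → ℝ} (hμ : IsFKGMeasure μ) (e : Fin 4 → ι)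
    (g : Fin 3 → (Fin 4 → Bool) → ℝ) (hg0 : ∀ i y, 0 ≤ g i y) (hmono : ∀ i, Monotone (g i)) :
    0 ≤ sahiE μ 3 fun i ω => g i (ω ∘ e) :=
  sahiE_comp_nonneg_of_forall_isFKGMeasure hμ
    { toFun := fun ω : ι → Bool => ω ∘ e, map_sup' := fun _ _ => rfl, map_inf' := fun _ _ => rfl }
    (fun _ hν => SahiC3CubeFourFKG.sahiPositive_three_cube_four hν) g hg0 hmono

/-- The indicator form: for three up-sets `A₀, A₁, A₂` of `{0,1}⁴` read on four fixed coordinates of an FKG weight on `{0,1}^ι`,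
`E₃(1_{A₀}(ω ∘ e), 1_{A₁}(ω ∘ e), 1_{A₂}(ω ∘ e)) ≥ 0`. [this work] -/
theorem sahiE_three_setInd_nonneg_of_fourCoordinates {μ : (ι → Bool) → ℝ} (hμ : IsFKGMeasure μ) (e : Fin 4 → ι)
    (A : Fin 3 → Finset (Fin 4 → Bool)) (hA : ∀ i, IsUpperSet (A i : Set (Fin 4 → Bool))) :
    0 ≤ sahiE μ 3 fun i ω => setInd (A i) (ω ∘ e) :=
  sahiE_three_nonneg_of_fourCoordinates hμ e (fun i => setInd (A i)) (fun _ _ => setInd_nonneg _ _)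
    fun i => monotone_setInd (hA i)

end Coordinates

/-! ### The finite-volume Ising ferromagnet: four sites -/

section Ising

open MeasureTheory Literature.Probability.LatticeModels SahiThreeCoordinates

variable {V : Type*} (Gr : SimpleGraph V) [DecidableEq V] [Gr.LocallyFinite]

/-- The up-spin reading `{−1,+1}⁴ → {0,1}⁴`, `y ↦ (y_a = 1)_a`, is injective and preserves `⊓`, `⊔`; hence every FKG probability weight
on `{−1,+1}⁴` is Sahi-positive of order `3` (P4's `sahiPositive_three_cube_four` + `sahiPositive_of_latticeEmbedding_at`). [this work] -/
theorem sahiPositive_three_spinCube_four {ν : (Fin 4 → ℤˣ) → ℝ} (hν : IsFKGMeasure ν) : SahiPositive ν 3 := by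
  refine sahiPositive_of_latticeEmbedding_at (L := Fin 4 → ℤˣ) (P := Fin 4 → Bool)
    (fun y a => decide (y a = 1)) ?_ ?_ ?_ (fun _ hρ => SahiC3CubeFourFKG.sahiPositive_three_cube_four hρ) hν
  · intro y y' hyy'
    funext a
    have ha := congrFun hyy' a
    simp only [decide_eq_decide] at ha
    rcases Int.units_eq_one_or (y a) with h1 | h1 <;> rcases Int.units_eq_one_or (y' a) with h2 | h2
    · rw [h1, h2]
    · exact absurd (ha.1 h1) (by rw [h2]; decide)
    · exact absurd (ha.2 h2) (by rw [h1]; decide)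
    · rw [h1, h2]
  · intro y y'
    funext a
    simp only [Pi.inf_apply]
    rw [show (decide (y a = 1) ⊓ decide (y' a = 1)) = (decide (y a = 1) && decide (y' a = 1)) from rfl,
      ← Bool.decide_and, decide_eq_decide, units_inf_eq_one_iff]
  · intro y y'
    funext a
    simp only [Pi.sup_apply]
    rw [show (decide (y a = 1) ⊔ decide (y' a = 1)) = (decide (y a = 1) || decide (y' a = 1)) from rfl,
      ← Bool.decide_or, decide_eq_decide, units_sup_eq_one_iff]

/-- **Ising, four sites, order 3.**  For the finite-volume Ising ferromagnet (`β ≥ 0`, any field `h`, any boundary condition `bc`, any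
finite `Λ`), any sites `v₀, v₁, v₂, v₃ : V` (repetitions and sites outside `Λ` allowed) and all nonnegative functions `g₀, g₁, g₂` of the
sub-configuration `(σ_{v₀}, σ_{v₁}, σ_{v₂}, σ_{v₃}) ∈ {−1,+1}⁴` that are nondecreasing in each spin:
`E₃^{μ_Λ}(g₀(σ_v), g₁(σ_v), g₂(σ_v)) ≥ 0` — Sahi's `C₃` for these observables, unconditionally. [this work] -/
theorem ising_sahiE_three_fourSites_nonneg (Λ : Finset V) {β : ℝ} (hβ : 0 ≤ β) (h : ℝ) (bc : BoundaryCondition V)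
    (v : Fin 4 → V) (g : Fin 3 → (Fin 4 → ℤˣ) → ℝ) (hg0 : ∀ i y, 0 ≤ g i y) (hmono : ∀ i, Monotone (g i)) :
    0 ≤ sahiE (fun τ : Λ → ℤˣ => isingWeight Gr Λ β h bc τ / isingPartitionFunction Gr Λ β h bc) 3
      fun i τ => g i fun a => glue Λ τ bc (v a) :=
  sahiE_comp_nonneg_of_forall_isFKGMeasure (isFKGMeasure_isingGibbsWeight Gr Λ hβ h bc)
    { toFun := fun (τ : Λ → ℤˣ) (a : Fin 4) => glue Λ τ bc (v a)
      map_sup' := fun τ τ' => by funext a; simp only [glue_sup, Pi.sup_apply]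
      map_inf' := fun τ τ' => by funext a; simp only [glue_inf, Pi.inf_apply] }
    (fun _ hν => sahiPositive_three_spinCube_four hν) g hg0 hmono

end Ising

/-! ### The random-cluster model: four edges -/

section RandomCluster

open MeasureTheory Literature.Probability.LatticeModels SahiThreeCoordinates

variable {V : Type*} [Fintype V] [DecidableEq V] (Gr : SimpleGraph V) [DecidableRel Gr.Adj]

/-- **Random-cluster model, four edges, order 3.**  For the random-cluster measure on a finite graph (`0 ≤ p ≤ 1`, `q ≥ 1`, any wired
set `B`), any four edges `e₀,…,e₃` and all nonnegative functions `g₀, g₁, g₂` of the four edge states, nondecreasing in each: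
`E₃(g₀, g₁, g₂) ≥ 0`. [this work] -/
theorem rc_sahiE_three_fourEdges_nonneg {p q : ℝ} (hp : p ∈ Set.Icc (0 : ℝ) 1) (hq : 1 ≤ q) (B : Set V)
    (e : Fin 4 → Sym2 V) (g : Fin 3 → (Fin 4 → Bool) → ℝ) (hg0 : ∀ i y, 0 ≤ g i y) (hmono : ∀ i, Monotone (g i)) :
    0 ≤ sahiE (fun ω : Finset (Sym2 V) =>
        (if ω ⊆ Gr.edgeFinset then rcWeight Gr p q B ω else 0) / rcPartitionFunction Gr p q B) 3
      fun i ω => g i fun a => decide (e a ∈ ω) :=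
  sahiE_comp_nonneg_of_forall_isFKGMeasure (isFKGMeasure_rcGibbsWeight Gr hp hq B)
    { toFun := fun (ω : Finset (Sym2 V)) (a : Fin 4) => decide (e a ∈ ω)
      map_sup' := fun ω ω' => by
        funext a
        simp only [Pi.sup_apply, Finset.sup_eq_union, Finset.mem_union, Bool.decide_or]
        rfl
      map_inf' := fun ω ω' => by
        funext a
        simp only [Pi.inf_apply, Finset.inf_eq_inter, Finset.mem_inter, Bool.decide_and]
        rfl }
    (fun _ hν => SahiC3CubeFourFKG.sahiPositive_three_cube_four hν) g hg0 hmono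

end RandomCluster

end Summit.CriticalPhenomena.PercolationContinuityZ3.Theorems.SahiFourCoordinates
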